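import Literature.NumberTheory.EllipticCurves.PAdicLFunction
import HarnessLib

/-!
# The tame branches `L_p(f, α, ω^i, T)` of the Mazur–Tate–Teitelbaum `p`-adic `L`-function (definitions)

Topic `NumberTheory/EllipticCurves`; namespace `Literature.NumberTheory.EllipticCurves`. Companion of
`PAdicLFunction` (item C19), which constructs the TRIVIAL tame branch
`L_p(f, α, T) = ∫_{ℤ_p^×} (1 + T)^{ℓ(x)} dμ_{f,α}(x)` of the MSD/MTT measure `μ_{f,α}` on `ℤ_p^×`.
Writing `ℤ_p^× = μ × Γ`, `x = ω(x) · γ^{ℓ(x)}` with `ω` the Teichmüller character (for odd `p`,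
`μ = μ_{p−1}` and `ω(x) ≡ x mod p`) and `γ = cyclotomicGenerator p`, the Iwasawa algebra of the full
cyclotomic `ℤ_p^×`-extension is `ℤ_p⟦ℤ_p^×⟧ = ⊕_i e_i ℤ_p⟦Γ⟧` and the measure `μ_{f,α}` has one power
series per character `ω^i` of `μ`: the **`ω^i`-branch**
`L_p(f, α, ω^i, T) = ∫_{ℤ_p^×} ω^i(x) (1 + T)^{ℓ(x)} dμ_{f,α}(x)` (Mazur–Tate–Teitelbaum 1986, §I.13:
"`L_p(f, α, χ, T)`" for a tame character `χ`; Greenberg–Vatsal 2000 §3 and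
arXiv:2412.16629 (Lei, Pollack et al., 2024) §1.3 write `L_p(E, ω^i, T)`). Its special values are the twisted values at the
characters `ω^i · κ` with `κ` a character of `Γ`: in particular its constant term is
`∫ ω^i dμ_{f,α} = α^{-1} ∑_{a mod p} ω^i(a) [a/p]⁺_f` for `i ≢ 0`, `= α^{-1} τ(ω^i) L(f, ω^{-i}, 1)/Ω⁺_f`
for EVEN `i` by Birch's formula (MTT §I.14 (14.3)); for ODD `i` the plus modular symbol gives `0` and
the genuine odd branch needs the MINUS symbol `[·]⁻` and `Ω⁻_f`, which the measure `msdMeasure` of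
`PAdicLFunction` (built from `ratPlusSymbol` only) does not carry — deliberately NOT here.

Contents (definitions + two unfolding lemmas, nothing asserted, no named fact): `padicLBranchRiemannSum`,
`padicLBranchCoeff`, `padicLFunctionBranch f α i`, `coeff_padicLFunctionBranch`,
`padicLBranchRiemannSum_zero` / `padicLFunctionBranch_zero` (the branch `i = 0` IS `padicLFunction`).
Motivation (cell `b2b-bsdres`, seat additive-p4, research line V9): for an elliptic curve `E/ℚ` with
ADDITIVE reduction of Kodaira type `I₀*` or `I_n*` at an odd `p` and `E♭ = E ⊗ χ_{p*}` its semistable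
quadratic twist (`p* = ±p ≡ 1 mod 4`, `χ_{p*} = ω^{(p−1)/2}`), the `p`-adic `L`-function relevant to
`BSD(E,p)` is the branch `L_p(f_{E♭}, α, ω^{(p−1)/2}, T)` (Delbourgo 1998 §1.5–1.6 "`f = f̃ ⊗ ε`";
arXiv:2412.16629 Thm. 4.3); Wuthrich 2014 Thm. 16 is a divisibility in `ℤ_p⟦ℤ_p^×⟧`, i.e.
branch by branch. For `p ≡ 1 (mod 4)` that branch is even and is the object defined here.

References: Mazur–Tate–Teitelbaum 1986 §I.13–I.14 [MazurTateTeitelbaum1986Invent]; Mazur–Swinnerton-Dyer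
1974 §9 [MazurSwinnertonDyer1974Invent].
-/

noncomputable section

open scoped MatrixGroups ModularForm

open CongruenceSubgroup Filter Topology Literature.NumberTheory.EllipticCurves.ModularForms

namespace Literature.NumberTheory.EllipticCurves

section Branch

variable {N : ℕ} (f : CuspForm (Gamma0 N) 2) {p : ℕ} [Fact p.Prime]

/-- The `n`-th **Riemann sum** for the `k`-th coefficient of the `ω^i`-branch `L_p(f, α, ω^i, T)`:
`∑_{η} η^i ∑_{s mod pⁿ} μ_{f,α}(η γˢ + p^{n+e₀}ℤ_p) · (s choose k)`, `η` over the Teichmüller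
representatives (the torsion of `ℤ_p^×`, on which `ω^i(η γ^t) = η^i`), `γ = cyclotomicGenerator p`;
a Riemann sum for `∫_{ℤ_p^×} ω^i(x) (ℓ(x) choose k) dμ_{f,α}(x)`. For `i = 0` this is literally
`padicLRiemannSum f α k n` (`padicLBranchRiemannSum_zero`). Mazur–Tate–Teitelbaum 1986, §I.13.
[cite: MazurTateTeitelbaum1986Invent, §I.13] -/
def padicLBranchRiemannSum (α : ℚ_[p]) (i k n : ℕ) : ℚ_[p] :=
  ∑ᶠ η : rootsOfUnity (torsionOrder p) ℤ_[p], ∑ s : ZMod (p ^ n),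
    ((((η : ℤ_[p]ˣ) : ℤ_[p]) : ℚ_[p]) ^ i *
      msdMeasure f α (n + cyclotomicExponent p)
          (PadicInt.toZModPow (n + cyclotomicExponent p) ((η : ℤ_[p]ˣ) : ℤ_[p]) *
            (cyclotomicGenerator p : ZMod (p ^ (n + cyclotomicExponent p))) ^ s.val) *
        (s.val.choose k : ℚ_[p]))

/-- The `k`-th **coefficient of the `ω^i`-branch**: `∫_{ℤ_p^×} ω^i(x) (ℓ(x) choose k) dμ_{f,α}(x)
= lim_n padicLBranchRiemannSum f α i k n` (junk value of `limUnder` if the limit does not exist, as for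
`padicLCoeff`; it exists when `μ_{f,α}` is a measure, `tendsto_padicLRiemannSum`, since `|η^i|_p = 1`).
Mazur–Tate–Teitelbaum 1986, §I.11–I.13. [cite: MazurTateTeitelbaum1986Invent, §I.11–I.13] -/
def padicLBranchCoeff (α : ℚ_[p]) (i k : ℕ) : ℚ_[p] :=
  limUnder atTop (padicLBranchRiemannSum f α i k)

/-- The **`ω^i`-branch of the `p`-adic `L`-function**, `L_p(f, α, ω^i, T) = ∫_{ℤ_p^×} ω^i(x) (1 + T)^{ℓ(x)} dμ_{f,α}(x)
∈ ℚ_p⟦T⟧` (`i : ℕ`, read modulo the order of the Teichmüller group; `T ↔ γ − 1`). For `i = 0` it is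
`padicLFunction f α` (`padicLFunctionBranch_zero`); for a character `κ` of `Γ`,
`L_p(f, α, ω^i, κ(γ) − 1) = ∫ ω^i κ dμ_{f,α}`, the value MTT interpolate at the Dirichlet character
`ω^i κ` (§I.14). Mazur–Tate–Teitelbaum 1986, §I.13. [cite: MazurTateTeitelbaum1986Invent, §I.13] -/
def padicLFunctionBranch (α : ℚ_[p]) (i : ℕ) : PowerSeries ℚ_[p] :=
  PowerSeries.mk (padicLBranchCoeff f α i)

/-- The `k`-th coefficient of `L_p(f, α, ω^i, T)` is `padicLBranchCoeff f α i k` (unfolding of the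
definition, MTT §I.13). [cite: MazurTateTeitelbaum1986Invent, §I.13] -/
@[simp] theorem coeff_padicLFunctionBranch (α : ℚ_[p]) (i k : ℕ) :
    PowerSeries.coeff k (padicLFunctionBranch f α i) = padicLBranchCoeff f α i k :=
  PowerSeries.coeff_mk _ _

/-- The constant term of `L_p(f, α, ω^i, T)` is `padicLBranchCoeff f α i 0 = ∫_{ℤ_p^×} ω^i dμ_{f,α}`
(unfolding, MTT §I.13). [cite: MazurTateTeitelbaum1986Invent, §I.13] -/
@[simp] theorem constantCoeff_padicLFunctionBranch (α : ℚ_[p]) (i : ℕ) :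
    PowerSeries.constantCoeff (padicLFunctionBranch f α i) = padicLBranchCoeff f α i 0 :=
  PowerSeries.constantCoeff_mk

/-- The branch `i = 0` Riemann sums are the Riemann sums of `padicLFunction` (`η^0 = 1`): the trivial
tame character gives MTT's `L_p(f, α, T)` (§I.13). [cite: MazurTateTeitelbaum1986Invent, §I.13] -/
theorem padicLBranchRiemannSum_zero (α : ℚ_[p]) (k n : ℕ) :
    padicLBranchRiemannSum f α 0 k n = padicLRiemannSum f α k n := by
  unfold padicLBranchRiemannSum padicLRiemannSum
  simp only [pow_zero, one_mul]

/-- **The trivial branch is the `p`-adic `L`-function of `PAdicLFunction`**: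
`L_p(f, α, ω^0, T) = L_p(f, α, T)` (MTT §I.13, the component of the trivial tame character).
[cite: MazurTateTeitelbaum1986Invent, §I.13] -/
theorem padicLFunctionBranch_zero (α : ℚ_[p]) :
    padicLFunctionBranch f α 0 = padicLFunction f α := by
  ext k
  simp only [coeff_padicLFunctionBranch, coeff_padicLFunction, padicLBranchCoeff, padicLCoeff]
  congr 1
  funext n
  exact padicLBranchRiemannSum_zero f α k n

end Branch

end Literature.NumberTheory.EllipticCurves

end
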